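import Summits.Parity.GeneralizedHardyLittlewood.Theorems.PrimeLevelFamEdgeMomentsBeyondDiagonalLayersPascadiBridge
import HarnessLib

/-!
# Route `PrimeLevelFamEdge`, crux K_A `MomentsBeyondDiagonal` (stmt-Parity-20007), line «petersson_layers» v4:
# Pascadi's Theorem 7.1 at modulus `c = q·r` for EVERY `r` — the layers with `q ∣ r` need no second fact (assembly step E6)

`…LayersPascadiBridge` typed the consumer's form of Pascadi's Theorem 7.1 through the instance `(d, d', e) = (r, 1, q)`, which needs
`q ∤ r`.  In the print band `r` runs up to `q̂^{ρ_W} > q`, so layers with `q ∣ r` occur.  For those the SAME theorem applies with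
`(d, d', e) = (r, q, 1)` (`d' = q ∣ d = r`, `(d, e) = (r, 1) = 1`), and in both cases `f = r` is the largest square divisor datum of
`c·d = q·r²` (for `q` prime, `g² ∣ q r² ⇒ g ∣ r`).  Hence the printed bound holds VERBATIM for all `r ≥ 1`:
* `dvd_of_sq_dvd_prime_mul_sq'`, `isMaxSqDiv_cofactor`: `IsMaxSqDiv r (q·r·r)` for every prime `q` and `r ≥ 1`;
* **`pascadi2025_theorem71_cofactor`**: the statement of `pascadi2025_theorem71_primeCofactor` WITHOUT the hypothesis `q ∤ r`;
* **`norm_bilinear_dilated_le_of_pascadi_cofactor`**, **`…_transposed_cofactor`**: the two bridges of `…LayersPascadiBridge`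
  without `q ∤ r` (proofs verbatim, through the cofactor instance).
The downstream per-class bounds (`…LayersClassPascadi`, `…LayersClassBound`) can be re-derived from these without their `q ∤ r`
hypothesis (mechanical; census E6).  Proof only (def-free, CONDITIONAL helper: the named fact is a HYPOTHESIS); nothing of
Pascadi's proof is formalised; K_A NOT proved; nothing about Landau–Siegel zeros.
-/

noncomputable section

open Finset
open Literature.NumberTheory.LFunctions

namespace Summit.Parity.GeneralizedHardyLittlewood.Theorems.MomentsBeyondDiagonal.Layers

/-! ## §1. The square-divisor datum `f = r` for every `r` -/

/-- For `q` prime and any `r`: `g² ∣ q·r²` forces `g ∣ r` (a prime is not divisible by a square `> 1`). [folklore] -/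
theorem dvd_of_sq_dvd_prime_mul_sq' {q r g : ℕ} (hq : q.Prime) (hg : g ^ 2 ∣ q * r ^ 2) : g ∣ r := by
  rcases Nat.eq_zero_or_pos g with rfl | hg0
  · -- `0 ∣ q r²` means `q r² = 0`, so `r = 0`
    rw [zero_pow two_ne_zero, zero_dvd_iff, mul_eq_zero] at hg
    rcases hg with h | h
    · exact absurd h hq.ne_zero
    · rw [pow_eq_zero_iff two_ne_zero] at h; rw [h]
  set d := Nat.gcd g r with hd
  have hd0 : 0 < d := Nat.gcd_pos_of_pos_left r hg0
  obtain ⟨g', hg'⟩ : d ∣ g := Nat.gcd_dvd_left g r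
  obtain ⟨r', hr'⟩ : d ∣ r := Nat.gcd_dvd_right g r
  have hcop : Nat.Coprime g' r' := by
    have h := Nat.coprime_div_gcd_div_gcd (m := g) (n := r) hd0
    rw [← hd] at h
    have e1 : g / d = g' := by rw [hg', Nat.mul_div_cancel_left _ hd0]
    have e2 : r / d = r' := by rw [hr', Nat.mul_div_cancel_left _ hd0]
    rwa [e1, e2] at h
  -- `g'² ∣ q r'²`, `(g'², r'²) = 1` ⇒ `g'² ∣ q` ⇒ `g' = 1`
  have h1 : g' ^ 2 ∣ q * r' ^ 2 := by
    have : (d * g') ^ 2 ∣ q * (d * r') ^ 2 := by rw [← hg', ← hr']; exact hg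
    rw [mul_pow, mul_pow, mul_left_comm] at this
    exact Nat.dvd_of_mul_dvd_mul_left (pow_pos hd0 2) this
  have h2 : g' ^ 2 ∣ q := (Nat.Coprime.pow 2 2 hcop).dvd_of_dvd_mul_right h1
  have hg'1 : g' = 1 := by
    rcases (Nat.dvd_prime hq).mp h2 with h | h
    · exact (pow_eq_one_iff.mp h).resolve_right two_ne_zero
    · exfalso
      -- `g'² = q`: then `g' ∣ q`, so `g' = 1` or `g' = q`; both contradict `q` prime
      have hg'q : g' ∣ q := ⟨g', by rw [← h]; ring⟩
      rcases (Nat.dvd_prime hq).mp hg'q with h1 | h1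
      · rw [h1, one_pow] at h
        exact hq.one_lt.ne h
      · rw [h1] at h
        have h2 := hq.one_lt
        nlinarith
  rw [hg', hg'1, mul_one, hr']
  exact Dvd.intro r' rfl


/-- For `q` prime and `r ≥ 1`: `r` is the largest integer whose square divides `(qr)·r`. [folklore] -/
theorem isMaxSqDiv_cofactor {q r : ℕ} (hq : q.Prime) (hr : 0 < r) : Pascadi2025.IsMaxSqDiv r (q * r * r) := by
  refine ⟨⟨q, by ring⟩, fun g hg ↦ ?_⟩
  have hg' : g ^ 2 ∣ q * r ^ 2 := by simpa [pow_two, mul_assoc] using hg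
  exact Nat.le_of_dvd hr (dvd_of_sq_dvd_prime_mul_sq' hq hg')

/-! ## §2. Theorem 7.1 at `c = q·r` for every `r` -/

/-- **Pascadi's Theorem 7.1 at modulus `c = q·r`, `q` prime, ANY `r ≥ 1`** (instance `(d,d',e) = (r,1,q)` if `q ∤ r`,
`(r,q,1)` if `q ∣ r`; `f = r` in both cases): the conclusion of `pascadi2025_theorem71_primeCofactor` without `q ∤ r`.
[cite: Pascadi2025, Thm. 7.1 (cases c = qr: (d,d',e) = (r,1,q) and (r,q,1), f = r)] -/
theorem pascadi2025_theorem71_cofactor (h : pascadi2025_theorem71) :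
    ∀ ε : ℝ, 0 < ε → ∃ C : ℝ, ∀ (q r : ℕ) [NeZero (q * r)], q.Prime →
      ∀ (M₀ N₀ : ℤ) (M N : ℕ), 1 ≤ N → N ≤ M → M ≤ q * r →
      ∀ (a : ZMod (q * r)), IsUnit a → ∀ (α β : ℤ → ℂ),
        ‖Pascadi2025.coprimeTypeIISum (q * r) a M₀ M N₀ N α β‖ ≤
          C * KSWX2023.l2Norm M₀ M α * KSWX2023.l2Norm N₀ N β * ((q * r : ℕ) : ℝ) ^ (1 + ε) *
            (Pascadi2025.bracket71 M N ((q * r : ℕ) : ℝ) r r) ^ (1 / 6 : ℝ) := by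
  intro ε hε
  obtain ⟨C, hC⟩ := h ε hε
  refine ⟨C, ?_⟩
  intro q r _ hq M₀ N₀ M N hN hNM hMc a ha α β
  have hr : 0 < r := by
    rcases Nat.eq_zero_or_pos r with h0 | h0
    · exact absurd (by rw [h0, mul_zero]) (NeZero.ne (q * r))
    · exact h0
  have hmax : Pascadi2025.IsMaxSqDiv r (q * r * r) := isMaxSqDiv_cofactor hq hr
  have hcast : ((q * r : ℕ) : ℝ) = (q : ℝ) * r := by push_cast; ring
  by_cases hqr : q ∣ r
  · -- instance `(d, d', e) = (r, q, 1)`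
    have key := hC (q * r) r q 1 r (by ring) hqr (Nat.coprime_one_right r) hmax M₀ N₀ M N hN hNM hMc a ha α β
    simpa [hcast] using key
  · -- instance `(d, d', e) = (r, 1, q)`
    have hcop : Nat.Coprime r q := (Nat.coprime_comm.mp ((hq.coprime_iff_not_dvd).mpr hqr))
    have key := hC (q * r) r 1 q r (by ring) (one_dvd r) hcop hmax M₀ N₀ M N hN hNM hMc a ha α β
    simpa [hcast] using key

/-! ## §3. The bridges without `q ∤ r` -/

/-- **Pascadi's Theorem 7.1 in the consumer's variables, every `r ≥ 1`** (CONDITIONAL on `pascadi2025_theorem71`):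
`‖Σ_{x≤X} Σ_{y≤Y} α_x β_y S(σ₁x, σ₂y; qr)‖ ≤ C ‖α‖₂ ‖β‖₂ (qr)^{1+ε} · bracket71(σ₁X, σ₂Y; qr, r, r)^{1/6}` for `1 ≤ σ₂Y ≤ σ₁X ≤ qr`
and coprime support — `…LayersPascadiBridge.norm_bilinear_dilated_le_of_pascadi` without `q ∤ r`.
[cite: Pascadi2025, Thm. 7.1 (case c = qr, a = 1)] -/
theorem norm_bilinear_dilated_le_of_pascadi_cofactor (h : pascadi2025_theorem71) {ε : ℝ} (hε : 0 < ε) :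
    ∃ C : ℝ, ∀ (q r : ℕ) [NeZero (q * r)], q.Prime →
      ∀ (σ₁ σ₂ X Y : ℕ), 0 < σ₁ → 0 < σ₂ → 1 ≤ σ₂ * Y → σ₂ * Y ≤ σ₁ * X → σ₁ * X ≤ q * r →
      ∀ (α β : ℕ → ℂ),
        (∀ x ∈ Icc 1 X, ∀ y ∈ Icc 1 Y, α x * β y ≠ 0 → Nat.Coprime (Nat.gcd (σ₁ * x) (σ₂ * y)) (q * r)) →
        ‖∑ x ∈ Icc 1 X, ∑ y ∈ Icc 1 Y, α x * β y *
            kloostermanSum (q * r) ((σ₁ * x : ℕ) : ZMod (q * r)) ((σ₂ * y : ℕ) : ZMod (q * r))‖ ≤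
          C * Real.sqrt (∑ x ∈ Icc 1 X, ‖α x‖ ^ 2) * Real.sqrt (∑ y ∈ Icc 1 Y, ‖β y‖ ^ 2) *
            ((q * r : ℕ) : ℝ) ^ (1 + ε) *
            (Pascadi2025.bracket71 (σ₁ * X : ℕ) (σ₂ * Y : ℕ) ((q * r : ℕ) : ℝ) r r) ^ (1 / 6 : ℝ) := by
  obtain ⟨C, hC⟩ := pascadi2025_theorem71_cofactor h ε hε
  refine ⟨C, ?_⟩
  intro q r _ hq σ₁ σ₂ X Y hσ₁ hσ₂ hN hNM hMc α β hcop
  have key := hC q r hq 0 0 (σ₁ * X) (σ₂ * Y) hN hNM hMc 1 isUnit_one (fun m : ℤ ↦ if 0 < m ∧ σ₁ ∣ m.toNat then α (m.toNat / σ₁) else 0)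
    (fun m : ℤ ↦ if 0 < m ∧ σ₂ ∣ m.toNat then β (m.toNat / σ₂) else 0)
  rw [l2Norm_dilate hσ₁, l2Norm_dilate hσ₂] at key
  -- identify Pascadi's restricted sum with ours
  have hsum : Pascadi2025.coprimeTypeIISum (q * r) 1 0 (σ₁ * X) 0 (σ₂ * Y) (fun m : ℤ ↦ if 0 < m ∧ σ₁ ∣ m.toNat then α (m.toNat / σ₁) else 0)
    (fun m : ℤ ↦ if 0 < m ∧ σ₂ ∣ m.toNat then β (m.toNat / σ₂) else 0) =
      ∑ x ∈ Icc 1 X, ∑ y ∈ Icc 1 Y, α x * β y *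
        kloostermanSum (q * r) ((σ₁ * x : ℕ) : ZMod (q * r)) ((σ₂ * y : ℕ) : ZMod (q * r)) := by
    unfold Pascadi2025.coprimeTypeIISum
    -- rewrite the indicator summand as `(fun m : ℤ ↦ if 0 < m ∧ σ₁ ∣ m.toNat then α (m.toNat / σ₁) else 0) m * (…)`
    have hterm : ∀ m n : ℤ,
        (if Nat.Coprime (Int.gcd m n) (q * r) then
          (fun m : ℤ ↦ if 0 < m ∧ σ₁ ∣ m.toNat then α (m.toNat / σ₁) else 0) m * (fun m : ℤ ↦ if 0 < m ∧ σ₂ ∣ m.toNat then β (m.toNat / σ₂) else 0) n * kloostermanSum (q * r) (1 * ((m : ℤ) : ZMod (q * r))) ((n : ℤ) : ZMod (q * r))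
          else 0) =
        (fun m : ℤ ↦ if 0 < m ∧ σ₁ ∣ m.toNat then α (m.toNat / σ₁) else 0) m * ((fun m : ℤ ↦ if 0 < m ∧ σ₂ ∣ m.toNat then β (m.toNat / σ₂) else 0) n *
          (if Nat.Coprime (Int.gcd m n) (q * r) then
            kloostermanSum (q * r) ((m : ℤ) : ZMod (q * r)) ((n : ℤ) : ZMod (q * r)) else 0)) := by
      intro m n
      split_ifs <;> simp [mul_assoc]
    simp_rw [hterm]
    simp_rw [← Finset.mul_sum]
    rw [sum_interval_dilate_mul hσ₁]
    refine Finset.sum_congr rfl fun x hx ↦ ?_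
    rw [sum_interval_dilate_mul hσ₂, Finset.mul_sum]
    refine Finset.sum_congr rfl fun y hy ↦ ?_
    by_cases hαβ : α x * β y = 0
    · have : α x * (β y * (if Nat.Coprime (Int.gcd ((σ₁ * x : ℕ) : ℤ) ((σ₂ * y : ℕ) : ℤ)) (q * r) then
          kloostermanSum (q * r) ((((σ₁ * x : ℕ) : ℤ) : ℤ) : ZMod (q * r)) ((((σ₂ * y : ℕ) : ℤ) : ℤ) : ZMod (q * r))
          else 0)) = 0 := by
        rw [← mul_assoc, hαβ, zero_mul]
      rw [this, hαβ, zero_mul]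
    · have hc : Nat.Coprime (Int.gcd ((σ₁ * x : ℕ) : ℤ) ((σ₂ * y : ℕ) : ℤ)) (q * r) := by
        rw [Int.gcd_natCast_natCast]
        exact hcop x hx y hy hαβ
      rw [if_pos hc]
      push_cast
      ring
  rw [hsum] at key
  exact key


/-- **The transposed bridge, every `r ≥ 1`** (`1 ≤ σ₁X ≤ σ₂Y ≤ qr`; bracket at `(σ₂Y, σ₁X)`).
[cite: Pascadi2025, Thm. 7.1 (footnote: m and n swapped)] -/
theorem norm_bilinear_dilated_le_of_pascadi_transposed_cofactor (h : pascadi2025_theorem71) {ε : ℝ} (hε : 0 < ε) :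
    ∃ C : ℝ, ∀ (q r : ℕ) [NeZero (q * r)], q.Prime →
      ∀ (σ₁ σ₂ X Y : ℕ), 0 < σ₁ → 0 < σ₂ → 1 ≤ σ₁ * X → σ₁ * X ≤ σ₂ * Y → σ₂ * Y ≤ q * r →
      ∀ (α β : ℕ → ℂ),
        (∀ x ∈ Icc 1 X, ∀ y ∈ Icc 1 Y, α x * β y ≠ 0 → Nat.Coprime (Nat.gcd (σ₁ * x) (σ₂ * y)) (q * r)) →
        ‖∑ x ∈ Icc 1 X, ∑ y ∈ Icc 1 Y, α x * β y *
            kloostermanSum (q * r) ((σ₁ * x : ℕ) : ZMod (q * r)) ((σ₂ * y : ℕ) : ZMod (q * r))‖ ≤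
          C * Real.sqrt (∑ x ∈ Icc 1 X, ‖α x‖ ^ 2) * Real.sqrt (∑ y ∈ Icc 1 Y, ‖β y‖ ^ 2) *
            ((q * r : ℕ) : ℝ) ^ (1 + ε) *
            (Pascadi2025.bracket71 (σ₂ * Y : ℕ) (σ₁ * X : ℕ) ((q * r : ℕ) : ℝ) r r) ^ (1 / 6 : ℝ) := by
  obtain ⟨C, hC⟩ := norm_bilinear_dilated_le_of_pascadi_cofactor h hε
  refine ⟨C, ?_⟩
  intro q r _ hq σ₁ σ₂ X Y hσ₁ hσ₂ hN hNM hMc α β hcop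
  -- swap the two variables: `S(σ₁x, σ₂y) = S(σ₂y, σ₁x)`
  have hswap : ∑ x ∈ Icc 1 X, ∑ y ∈ Icc 1 Y, α x * β y *
      kloostermanSum (q * r) ((σ₁ * x : ℕ) : ZMod (q * r)) ((σ₂ * y : ℕ) : ZMod (q * r)) =
      ∑ y ∈ Icc 1 Y, ∑ x ∈ Icc 1 X, β y * α x *
        kloostermanSum (q * r) ((σ₂ * y : ℕ) : ZMod (q * r)) ((σ₁ * x : ℕ) : ZMod (q * r)) := by
    rw [Finset.sum_comm]
    refine Finset.sum_congr rfl fun y _ ↦ Finset.sum_congr rfl fun x _ ↦ ?_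
    rw [kloostermanSum_comm, mul_comm (α x)]
  rw [hswap]
  have hcop' : ∀ y ∈ Icc 1 Y, ∀ x ∈ Icc 1 X, β y * α x ≠ 0 →
      Nat.Coprime (Nat.gcd (σ₂ * y) (σ₁ * x)) (q * r) := by
    intro y hy x hx hne
    rw [Nat.gcd_comm]
    exact hcop x hx y hy (by rwa [mul_comm] at hne)
  have key := hC q r hq σ₂ σ₁ Y X hσ₂ hσ₁ hN hNM hMc β α hcop'
  calc ‖∑ y ∈ Icc 1 Y, ∑ x ∈ Icc 1 X, β y * α x *
          kloostermanSum (q * r) ((σ₂ * y : ℕ) : ZMod (q * r)) ((σ₁ * x : ℕ) : ZMod (q * r))‖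
      ≤ C * Real.sqrt (∑ y ∈ Icc 1 Y, ‖β y‖ ^ 2) * Real.sqrt (∑ x ∈ Icc 1 X, ‖α x‖ ^ 2) *
          ((q * r : ℕ) : ℝ) ^ (1 + ε) *
          (Pascadi2025.bracket71 (σ₂ * Y : ℕ) (σ₁ * X : ℕ) ((q * r : ℕ) : ℝ) r r) ^ (1 / 6 : ℝ) := key
    _ = _ := by ring


end Summit.Parity.GeneralizedHardyLittlewood.Theorems.MomentsBeyondDiagonal.Layers

end
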